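import Summits.BirchSwinnertonDyer.Rank1Residual.F1Sign2.TwoAdicBSDRankOneSsAtTwo
import Summits.BirchSwinnertonDyer.BirchSwinnertonDyer.Theorems.ByReductionTypeAtTwoRankOnePerrinRiouShaOrderAtTwo
import HarnessLib

/-!
# The `♯/♭ ↔ η` bridge at `2`: Sprung's Perrin-Riou element `PR = B(a₂)·[T¹]L♯ − A(a₂)·[T¹]L♭` and the
# `η`-coordinate `Λ_η` of the `D`-valued `2`-adic leading term have `‖Λ_η‖₂ = ‖PR‖₂ / 4` (B56, conjecture-grade,
# ANALYTIC — no Ш, no point, no height), with its valuation form proved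

Cell `bsd-f1-sign2`, seat `-an` g52 (MEMO-an §56.10), crux `stmt-BirchSwinnertonDyer-23715`; helper file, closes nothing.

WHY.  MEMO-an §56 placed the `-an` statements 55B / 56A / 56A-K / 56A-L (`♯/♭` currency: ONE element
`PR ∈ ℚ₂` built from Sprung's integral pair, `IsSprungPair`) as TWINS of the `-es` tree statements K2-Tss / K2-Vss /
K2-Kss / K2-Lss (`η`-channel currency: `Λ_η = ssLeadingEta W 2 L v`, `L` the `D`-valued derivative vector of the receptacle
`IsSsLDerivVector`, `(u, v)` a Katz Frobenius column).  The two currencies meet in exactly ONE analytic statement, typed here: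
**B56 `SprungEtaBridgeAtTwo`** — for a globally minimal `W` with good supersingular reduction at `2` and `r_an = 1`, every
newform `f` of `W`, every Sprung pair `(L♯, L♭)` of `f` at `2`, every `D`-valued derivative vector `L` and every Katz column
`(u, v)`: `‖Λ_η‖₂ = ‖PR‖₂/4`.  (Eliminating `Ш`, `Tam`, `ϖ`, `#tors` (odd at a supersingular `2`) and the point between K2-Tss and
55B gives exactly this; conversely B56 is what turns either family into the other once the two formal-logarithm decls
`prLog` / `logOmegaAt` are compared on odd-index points — NOT done here, see "NOT PROVED".)  The factor `4 = ‖log₂ 5‖₂⁻¹`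
is the `d/ds ↔ d/dT` conversion (`T = 5^{s−1} − 1`); the restriction `r_an = 1` is real: at `r_an = 0` the `T⁰`-coefficients of
`(L♯, L♭)` enter `[s¹]L_D` through the derivatives of the half-logarithms and `PR` is no longer the `η`-row (55D
`PerrinRiouVanishingOrderAtTwo` is the `r_an ≥ 1` input).

CENSUS (BC5-style, two engines, `Cruxes/RankOneAtTwoBigImageOddLocal/CensusAN59.md`): on the 256 optimal rank-1
good-supersingular-at-2 curves with `4005 ≤ N ≤ 5000` common to `-an`'s exact `v₂(PR)` table (g51 `pr55_rows.json`, modular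
symbols, finite level, certified precision) and `-es`'s DES16 block A (`ϖ = 1`; `-es`'s `B·v_F` is the Tamagawa/torsion-normalised
`Λ_η`, so the tested form is `v₂(PR) = v₂(B·v_F) + v₂(Tam) − 2`): ENGINE 5 (eclib Riemann sums, `DES16-E5A-v1.tsv`): exact rows
AGREE 218/218, bound rows consistent 38/38, violations 0; ENGINE 1 (PARI `ellpadicbsd`, rows where `-es`'s own T1 check is sound):
163/163, and ENGINE 1 = ENGINE 5 on 163/163.  By `a₂ ∈ {0, −2, 2}`: 73/48/42 (ENGINE 1 exact rows).  No arithmetic input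
(`Ш`, points, heights) enters this comparison except through `-es`'s normalisation by `Tam` (an integer read off both tables).

CONTENT: `SprungEtaBridgeAtTwo` (B56, `@[conjecture]`); PROVED: `valuation_ssLeadingEta_of_bridge` (B56 ⟹ for `PR ≠ 0`,
`v₂(Λ_η) = v₂(PR) + 2` and `Λ_η ≠ 0`) — the form in which B56 meets the valuation-typed 56A — and `ssLeadingEta_ne_zero_iff_of_bridge`.
NOT PROVED (next generation): `B56 → (56A ↔ K2-Vss on SliceAtTwo)`, which needs (i) `padicLogOrd W 2 ι P = (logOmegaAt W 2 P₀).valuation`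
for an odd-index `P` and a Mordell–Weil basis `P₀` (comparison of `padicLogPoint ∘ padicPointOf` with `Kato2004.padicLogLocal`, plus
`E(ℚ) = ℤP₀ ⊕ tors`), (ii) `#tors` odd at a good supersingular `2` (tree: `irreducible_twoDivisionCubic_of_goodSS`).
HONEST FRAMING: B56 is print-transfer in nature (Sprung 2012 Def. 6.1/Lemma 6.9-type `L_α = L♯·log♯_α + L♭·log♭_α` at `p = 2`, `T¹`-coefficients,
composed with the Kurihara–Pollack `D`-valued `L′`); it is typed `@[conjecture]` only because neither receptacle's analytic theory is in the
tree.  BSD is not proved by any of this; 23715 is not closed.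
References: [cite: Sprung2012, §6] [cite: KuriharaPollack2007, (9)–(11)] [cite: Sprung2017, Thm. 1.3] [cite: Kobayashi2013, Cor. 1.3(ii)].
-/

set_option linter.dupNamespace false

noncomputable section

open scoped Classical MatrixGroups ModularForm

open CongruenceSubgroup PowerSeries WeierstrassCurve Literature.NumberTheory.EllipticCurves
  Literature.NumberTheory.EllipticCurves.ModularForms Literature.NumberTheory.EllipticCurves.Sprung2017
  Literature.NumberTheory.EllipticCurves.Rank1Residual Summit.BirchSwinnertonDyer.Rank1Residual.F1Sign2

namespace Summit.BirchSwinnertonDyer.BirchSwinnertonDyer.Theorems.PerrinRiouElementAtTwo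

/-- **B56 `SprungEtaBridgeAtTwo` (conjecture-grade; ANALYTIC bridge between the `♯/♭` and the `η` currencies at `2`).**
For `W` globally minimal with good supersingular reduction at `2` and `r_an(W) = 1`, `f` a newform of `W`, `(L♯, L♭)` a Sprung pair of
`f` at `2`, `L` a `D`-valued `2`-adic derivative vector of `f` (receptacle `IsSsLDerivVector`) and `(u, v)` a Katz Frobenius column:
`‖ssLeadingEta W 2 L v‖₂ = ‖B(a₂)·[T¹]L♯ − A(a₂)·[T¹]L♭‖₂ / 4`.  Census: 218/218 exact + 38/38 bound rows, two engines (module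
docstring).  Why it might fail: a normalisation of `-es`'s receptacle (`(1 − ½Φ)⁻²`, the measure `μ_D`, `c_∞`) differing from PARI/eclib's by a
power of `2` on some class of curves not in the census range (`N ≤ 5000`, optimal); the statement is rank-free in form only for `r_an ≥ 1`.
[cite: Sprung2012, §6] [cite: KuriharaPollack2007, (9)–(11)] -/
@[conjecture] def SprungEtaBridgeAtTwo : Prop :=
  ∀ {N : ℕ} [NeZero N] (f : CuspForm (Gamma0 N) 2) (W : WeierstrassCurve ℚ) [W.IsElliptic] [W.IsGloballyMinimal]
    (Lsharp Lflat : IwasawaAlgebra 2) (L : Fin 2 → ℚ_[2]) (u v : ℚ_[2]),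
    GoodSS W 2 → W.analyticRank = 1 → IsNewformOf W f →
    IsSprungPair f 2 (W.frobeniusTrace 2) Lsharp Lflat → IsSsLDerivVector W 2 f L → IsKatzFrobeniusColumn W 2 u v →
    ‖ssLeadingEta W 2 L v‖ = 4⁻¹ * ‖prComb (W.frobeniusTrace 2) Lsharp Lflat‖

/-- Norm-to-valuation conversion in `ℚ_[2]`: `‖x‖ = 4⁻¹·‖y‖` with `y ≠ 0` forces `x ≠ 0` and `v(x) = v(y) + 2`. [folklore] -/
theorem valuation_eq_add_two_of_norm_eq {x y : ℚ_[2]} (hy : y ≠ 0) (h : ‖x‖ = 4⁻¹ * ‖y‖) :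
    x ≠ 0 ∧ x.valuation = y.valuation + 2 := by
  have hx : x ≠ 0 := by
    intro hx0; rw [hx0, norm_zero] at h
    have : 0 < ‖y‖ := norm_pos_iff.mpr hy
    linarith
  refine ⟨hx, ?_⟩
  have hxv := Padic.norm_eq_zpow_neg_valuation hx
  have hyv := Padic.norm_eq_zpow_neg_valuation hy
  have h2 : ((2 : ℕ) : ℝ) ^ (-x.valuation) = ((2 : ℕ) : ℝ) ^ (-(2 : ℤ) + -y.valuation) := by
    rw [zpow_add₀ (by norm_num : ((2 : ℕ) : ℝ) ≠ 0), ← hxv, ← hyv, h]; norm_num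
  have := zpow_right_injective₀ (by norm_num : (0 : ℝ) < (2 : ℕ)) (by norm_num : ((2 : ℕ) : ℝ) ≠ 1) h2
  omega

/-- **B56 in valuation form (PROVED from B56):** for `PR ≠ 0`, `Λ_η ≠ 0` and `v₂(Λ_η) = v₂(PR) + 2` — the shape in which the bridge meets
the valuation-typed 56A `PerrinRiouShaOrderAtTwo` and the norm-typed K2-Vss `TwoAdicBSDEtaValRankOneSs`. [folklore] -/
theorem valuation_ssLeadingEta_of_bridge (hB : SprungEtaBridgeAtTwo)
    {N : ℕ} [NeZero N] (f : CuspForm (Gamma0 N) 2) (W : WeierstrassCurve ℚ) [W.IsElliptic] [W.IsGloballyMinimal]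
    (Lsharp Lflat : IwasawaAlgebra 2) (L : Fin 2 → ℚ_[2]) (u v : ℚ_[2])
    (hss : GoodSS W 2) (hrk : W.analyticRank = 1) (hnf : IsNewformOf W f)
    (hpair : IsSprungPair f 2 (W.frobeniusTrace 2) Lsharp Lflat) (hL : IsSsLDerivVector W 2 f L)
    (huv : IsKatzFrobeniusColumn W 2 u v) (hPR : prComb (W.frobeniusTrace 2) Lsharp Lflat ≠ 0) :
    ssLeadingEta W 2 L v ≠ 0 ∧
      (ssLeadingEta W 2 L v).valuation = (prComb (W.frobeniusTrace 2) Lsharp Lflat).valuation + 2 :=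
  valuation_eq_add_two_of_norm_eq hPR (hB f W Lsharp Lflat L u v hss hrk hnf hpair hL huv)

/-- Under B56 the two leading coefficients vanish together. [folklore] -/
theorem ssLeadingEta_ne_zero_iff_of_bridge (hB : SprungEtaBridgeAtTwo)
    {N : ℕ} [NeZero N] (f : CuspForm (Gamma0 N) 2) (W : WeierstrassCurve ℚ) [W.IsElliptic] [W.IsGloballyMinimal]
    (Lsharp Lflat : IwasawaAlgebra 2) (L : Fin 2 → ℚ_[2]) (u v : ℚ_[2])
    (hss : GoodSS W 2) (hrk : W.analyticRank = 1) (hnf : IsNewformOf W f)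
    (hpair : IsSprungPair f 2 (W.frobeniusTrace 2) Lsharp Lflat) (hL : IsSsLDerivVector W 2 f L)
    (huv : IsKatzFrobeniusColumn W 2 u v) :
    ssLeadingEta W 2 L v ≠ 0 ↔ prComb (W.frobeniusTrace 2) Lsharp Lflat ≠ 0 := by
  have h := hB f W Lsharp Lflat L u v hss hrk hnf hpair hL huv
  constructor
  · intro hη hPR
    rw [hPR, norm_zero, mul_zero] at h
    exact hη (norm_eq_zero.mp h)
  · intro hPR
    exact (valuation_ssLeadingEta_of_bridge hB f W Lsharp Lflat L u v hss hrk hnf hpair hL huv hPR).1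

end Summit.BirchSwinnertonDyer.BirchSwinnertonDyer.Theorems.PerrinRiouElementAtTwo
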